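import Literature.AlgebraicGeometry.Resolution.VertexBlowupCharts
import Literature.AlgebraicGeometry.Resolution.RationalFunctionsToProjectiveSpace
import Literature.AlgebraicGeometry.Resolution.BlowupsIntegral
import Literature.AlgebraicGeometry.Motives.ProjectiveSpaceFunctionField
import HarnessLib

/-!
# The blow-up of `ℙ^{d+1}` in the vertex: the rational functions `x₀/x_{d+1}, …, x_d/x_{d+1}`

Topic: `Literature/AlgebraicGeometry/Resolution`. Second scheme-level step of the construction of
de Jong 1996, proof of Lemma 4.11 (p. 68): the blowing up `b : P̃ → ℙ^{d+1}_k` of projective space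
in the vertex `p = (0 : … : 0 : 1)` and the linear projection `q = pr_p : P̃ → ℙ^d`,
`(x₀ : … : x_{d+1}) ↦ (x₀ : … : x_d)` ("`f` along `Eᵢ` looks like `pr_p : P̃^d → ℙ^{d-1}`"). The
projection will be the morphism of the VECTOR OF RATIONAL FUNCTIONS `(z₀ : … : z_d)`,
`z_j = b^*(x_j/x_{d+1}) ∈ K(P̃)` (`Resolution/RationalFunctionsToProjectiveSpace.lean`:
`toProjOfVec`, Hartshorne II Thm. 7.1); this file PROVES that this rational map is defined
everywhere on `P̃` (`DeJong1996.isDefinedAt_blowupRatFn`), for ANY blowing up `b` of `ℙ^{d+1}_k`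
in the vertex:

* `DeJong1996.vertexRatFn d k j = x_j/x_{d+1} ∈ K(ℙ^{d+1})` — the ratio of the generating sections
  `x_j`, `x_{d+1}` of `𝒪(1)` (`GeneratingSections.ratioFn` of `GeneratingSections.ofHom (𝟙 ℙ)`);
  non-zero; `x_l/x_{d+1} / (x_j/x_{d+1}) = x_l/x_j` is regular on `D₊(x_j)`; and it is the rational
  function of the section `xⱼ/x_{d+1} ∈ Γ(D₊(x_{d+1}))` of `VertexBlowupCharts.lean`
  (`ofSection_vertexSection`; through `ProjSpace.sec_eq_awayToSection`, identifying the tree's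
  and Mathlib's section isomorphisms `(k[x]_{(x_l)})₀ ≅ Γ(D₊(x_l))`);
* `DeJong1996.blowupRatFn b j = z_j = b^*(x_j/x_{d+1}) ∈ K(P̃)` (`RatFn.functionFieldMap` along
  the dominant `b`); non-zero, and:
  - off the exceptional locus: `z_l/z_j = b^*(x_l/x_j)` is regular on `b⁻¹ D₊(x_j)`, `j ≤ d`
    (`isRegularAt_blowupRatFn_div_of_mem_basicOpen`);
  - on the `i`-th chart `Spec k[X][I/Xᵢ] → P̃` over `D₊(x_{d+1})` (`vertexChart`): `z_l/zᵢ` is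
    regular, being the rational function of the quotient `c` in `b^*Xₗ = c · b^*Xᵢ` on any
    principal affine piece, where `b^*Xᵢ` generates the exceptional ideal
    (`isRegularAt_blowupRatFn_div_of_mem_opensRange`);
  - hence **`(z₀ : … : z_d)` is defined at every point of `P̃`** (`isDefinedAt_blowupRatFn`), with
    `b⁻¹ D₊(x_j)` and the `i`-th chart contained in the `j`-th resp. `i`-th chart of the linear
    system (`preimage_basicOpen_le_lsChart`, `opensRange_vertexChart_le_lsChart`).

Everything is PROVED; no named facts, no new definitions beyond abbreviations for the rational
functions and sections involved.

## Sources

* A. J. de Jong, *Smoothness, semi-stability and alterations*, Publ. Math. IHÉS 83 (1996),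
  proof of Lemma 4.11, p. 68. [DeJong1996]
* R. Hartshorne, *Algebraic Geometry* (1977), II Thm. 7.1 (morphisms to `ℙⁿ`), II Prop. 2.5 (b).
  [Hartshorne1977]
* The Stacks Project, Tag 0804 (charts of a blowing up). [StacksProject]
-/

noncomputable section

open CategoryTheory CategoryTheory.Limits AlgebraicGeometry TopologicalSpace HomogeneousLocalization

attribute [local instance] MvPolynomial.gradedAlgebra

namespace Literature.AlgebraicGeometry.Motives.ProjSpace

universe u

open Literature.AlgebraicGeometry.Motives.Segre

variable {d : ℕ} {K : Type u} [Field K]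

/-- The chart morphism `D₊(x_l) → Spec (K[x]_{(x_l)})₀` of the generating sections of `𝟙 ℙ^d`
(`GeneratingSections.chartLift`) is Mathlib's `Proj.basicOpenIsoSpec` (both lift the inclusion
`D₊(x_l) ↪ ℙ^d` through the open immersion `awayι`). [folklore] -/
theorem chartLift_id_eq (l : Fin (d + 1)) :
    GeneratingSections.chartLift (𝟙 (P d K)) l =
      (Proj.basicOpenIsoSpec (grading (Fin (d + 1)) K) (MvPolynomial.X l) (X_mem K l) zero_lt_one).hom := by
  refine (IsOpenImmersion.lift_uniq (chartι K l) ((GeneratingSections.preU (𝟙 (P d K)) l).ι ≫ 𝟙 (P d K))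
    _ _ ?_).symm
  rw [Category.comp_id]
  change _ ≫ Proj.awayι _ _ (X_mem K l) zero_lt_one = (Proj.basicOpen (grading (Fin (d + 1)) K) (MvPolynomial.X l)).ι
  rw [← Proj.basicOpenIsoSpec_inv_ι _ _ (X_mem K l) zero_lt_one, Iso.hom_inv_id_assoc]

/-- **The two section isomorphisms agree**: the tree's transport `sec l a` of a degree-zero
fraction `a ∈ (K[x]_{(x_l)})₀` to a section over `D₊(x_l)` is Mathlib's `Proj.awayToSection`.
[folklore] -/
theorem sec_eq_awayToSection (l : Fin (d + 1)) (a : Away (grading (Fin (d + 1)) K) (MvPolynomial.X l)) :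
    sec l a = Proj.awayToSection (grading (Fin (d + 1)) K) (MvPolynomial.X l) a := by
  rw [sec, chartLift_id_eq, pull_apply, Proj.basicOpenIsoSpec_hom]
  change (U l).topIso.hom (((Proj.basicOpenToSpec (grading (Fin (d + 1)) K) (MvPolynomial.X l)).app ⊤)
    ((Scheme.ΓSpecIso _).inv a)) = _
  rw [Proj.basicOpenToSpec_app_top]
  change (U l).topIso.hom ((Proj.basicOpen (grading (Fin (d + 1)) K) (MvPolynomial.X l)).topIso.inv
    (Proj.awayToSection (grading (Fin (d + 1)) K) (MvPolynomial.X l)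
      ((Scheme.ΓSpecIso (.of (Away (grading (Fin (d + 1)) K) (MvPolynomial.X l)))).hom
        ((Scheme.ΓSpecIso (.of (Away (grading (Fin (d + 1)) K) (MvPolynomial.X l)))).inv a)))) = _
  rw [Iso.inv_hom_id_apply]
  exact Iso.inv_hom_id_apply _ _

end Literature.AlgebraicGeometry.Motives.ProjSpace

namespace Literature.AlgebraicGeometry.Resolution

universe u

open Literature.AlgebraicGeometry.Motives (projectiveSpace GeneratingSections)
open Literature.AlgebraicGeometry.Motives.Segre (grading chartι toSpec X_mem frac)
open Literature.AlgebraicGeometry.Motives.RatFn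

namespace DeJong1996

variable (d : ℕ) (k : Type u) [Field k]

/-! ## The rational functions `x_j/x_{d+1}` on `ℙ^{d+1}` -/

/-- The generating sections `x₀, …, x_{d+1}` of `𝒪(1)` on `ℙ^{d+1}_k` in chart form (the data of
the identity morphism, Hartshorne II Thm. 7.1 (a)). [cite: Hartshorne1977, II Thm. 7.1 (a)] -/
abbrev gensP : GeneratingSections (Fin (d + 1 + 1)) (Proj (grading (Fin (d + 1 + 1)) k)) :=
  GeneratingSections.ofHom (𝟙 (Proj (grading (Fin (d + 1 + 1)) k)))

/-- The generic point of `ℙ^{d+1}` lies in the last chart. [folklore] -/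
theorem genericPoint_mem_U_last :
    genericPoint (Proj (grading (Fin (d + 1 + 1)) k)) ∈ (gensP d k).U (Fin.last (d + 1)) :=
  Motives.ProjSpace.genericPoint_mem_U (Fin.last (d + 1))

/-- **`x_j/x_{d+1} ∈ K(ℙ^{d+1}_k)`**, `j ≤ d`: the ratio of the generating sections `x_j` and
`x_{d+1}` (`GeneratingSections.ratioFn`). [cite: DeJong1996, Lemma 4.11 (proof), p. 68] -/
def vertexRatFn (j : Fin (d + 1)) : (Proj (grading (Fin (d + 1 + 1)) k)).functionField :=
  (gensP d k).ratioFn (Fin.last (d + 1)) (Fin.castSucc j) (genericPoint_mem_U_last d k)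

/-- `x_j/x_{d+1} ≠ 0`. [folklore] -/
theorem vertexRatFn_ne_zero (j : Fin (d + 1)) : vertexRatFn d k j ≠ 0 :=
  (gensP d k).ratioFn_ne_zero _ _ _ (Motives.ProjSpace.genericPoint_mem_U (Fin.castSucc j))

/-- **`(x_l/x_{d+1}) / (x_j/x_{d+1}) = x_l/x_j`** in `K(ℙ^{d+1})` (the cocycle rule of the
ratios). [folklore] -/
theorem vertexRatFn_div (l j : Fin (d + 1)) :
    vertexRatFn d k l / vertexRatFn d k j =
      (gensP d k).ratioFn (Fin.castSucc j) (Fin.castSucc l)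
        (Motives.ProjSpace.genericPoint_mem_U (Fin.castSucc j)) := by
  rw [div_eq_iff (vertexRatFn_ne_zero d k j), mul_comm]
  exact ((gensP d k).ratioFn_mul_ratioFn (Fin.last (d + 1)) (Fin.castSucc j) (Fin.castSucc l)
    (genericPoint_mem_U_last d k) (Motives.ProjSpace.genericPoint_mem_U (Fin.castSucc j))).symm

/-- `x_l/x_j` is regular on `D₊(x_j)`. [folklore] -/
theorem isRegularAt_vertexRatFn_div {l j : Fin (d + 1)} {y : Proj (grading (Fin (d + 1 + 1)) k)}
    (hy : y ∈ Proj.basicOpen (grading (Fin (d + 1 + 1)) k) (MvPolynomial.X (Fin.castSucc j))) :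
    IsRegularAt y (vertexRatFn d k l / vertexRatFn d k j) := by
  rw [vertexRatFn_div]
  exact (gensP d k).isRegularAt_ratioFn (Fin.castSucc l) (i := Fin.castSucc j) hy

/-- The generic point of `ℙ^{d+1}` lies in `D₊(x_{d+1})` (the same statement, for the affine
open `lastChart`). [folklore] -/
theorem genericPoint_mem_lastChart :
    genericPoint (Proj (grading (Fin (d + 1 + 1)) k)) ∈
      (lastChart d k : (Proj (grading (Fin (d + 1 + 1)) k)).Opens) :=
  Motives.ProjSpace.genericPoint_mem_U (Fin.last (d + 1))

/-- The section `xⱼ/x_{d+1} ∈ Γ(D₊(x_{d+1}))` of `VertexBlowupCharts.lean` is the ratio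
`x_j/x_{d+1}` of the generating sections of `𝟙 ℙ^{d+1}` (same section, through
`ProjSpace.sec_eq_awayToSection`). [folklore] -/
theorem vertexSection_eq_ratio (j : Fin (d + 1)) :
    vertexSection d k j = (gensP d k).ratio (Fin.last (d + 1)) (Fin.castSucc j) := by
  rw [vertexSection_eq, ← isLocalizationElem_eq_chartGen]
  exact (Motives.ProjSpace.sec_eq_awayToSection (Fin.last (d + 1)) (frac k (Fin.last (d + 1))
    (Fin.castSucc j))).symm

/-- **The rational function of the section `xⱼ/x_{d+1}` is `x_j/x_{d+1}`.** [folklore] -/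
theorem ofSection_vertexSection (j : Fin (d + 1)) :
    ofSection (genericPoint_mem_lastChart d k) (vertexSection d k j) = vertexRatFn d k j := by
  rw [vertexSection_eq_ratio]
  rfl

/-! ## The blowing up is integral and dominant -/

/-- The ideal sheaf of the vertex is non-zero (its sections over `D₊(x_{d+1})` contain
`x₀/x_{d+1} ≠ 0`). [folklore] -/
theorem vertexIdealSheaf_ne_bot : vertexIdealSheaf d k ≠ ⊥ := by
  intro h
  have hmem := vertexSection_mem d k 0
  rw [h, Scheme.IdealSheafData.ideal_bot, Pi.bot_apply, Ideal.mem_bot] at hmem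
  have := congrArg (lastChartEquiv d k) hmem
  rw [lastChartEquiv_vertexSection, map_zero] at this
  exact MvPolynomial.X_ne_zero _ this

variable {d k}
variable {P : Scheme.{u}} {b : P ⟶ Proj (grading (Fin (d + 1 + 1)) k)}

/-- A blowing up of `ℙ^{d+1}_k` in the vertex is an integral scheme (Stacks 02ND).
[cite: StacksProject, Tag 02ND] -/
theorem isIntegral_of_isBlowup_vertex (hb : IsBlowup b (vertexIdealSheaf d k)) : IsIntegral P :=
  hb.isIntegral (vertexIdealSheaf_ne_bot d k)

/-- A blowing up of `ℙ^{d+1}_k` in the vertex is dominant (indeed birational, Stacks 02ND).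
[cite: StacksProject, Tag 02ND] -/
theorem isDominant_of_isBlowup_vertex (hb : IsBlowup b (vertexIdealSheaf d k)) : IsDominant b :=
  (hb.isBirational' (vertexIdealSheaf_ne_bot d k)).isDominant

/-! ## The rational functions `z_j = b^*(x_j/x_{d+1})` on the blowing up -/

section RatFn

variable (b) [IsIntegral P] [IsDominant b]

/-- **`z_j = b^*(x_j/x_{d+1}) ∈ K(P̃)`**, the pull-back of `x_j/x_{d+1}` along the dominant `b`
(the `j`-th homogeneous coordinate of the projection `q = pr_p ∘ b`).
[cite: DeJong1996, Lemma 4.11 (proof), p. 68] -/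
def blowupRatFn (j : Fin (d + 1)) : P.functionField :=
  functionFieldMap b (vertexRatFn d k j)

/-- `z_j ≠ 0`. [folklore] -/
theorem blowupRatFn_ne_zero (j : Fin (d + 1)) : blowupRatFn b j ≠ 0 :=
  (map_ne_zero (functionFieldMap b)).mpr (vertexRatFn_ne_zero d k j)

/-- `z_l/z_j = b^*(x_l/x_j)`. [folklore] -/
theorem blowupRatFn_div (l j : Fin (d + 1)) :
    blowupRatFn b l / blowupRatFn b j = functionFieldMap b (vertexRatFn d k l / vertexRatFn d k j) := by
  rw [map_div₀]
  rfl

/-- **Off the exceptional locus**: `z_l/z_j` is regular at every point over `D₊(x_j)`, `j ≤ d`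
(there it is the pull-back of the regular function `x_l/x_j`). [folklore] -/
theorem isRegularAt_blowupRatFn_div_of_mem_basicOpen {l j : Fin (d + 1)} {x : P}
    (hx : b x ∈ Proj.basicOpen (grading (Fin (d + 1 + 1)) k) (MvPolynomial.X (Fin.castSucc j))) :
    IsRegularAt x (blowupRatFn b l / blowupRatFn b j) := by
  rw [blowupRatFn_div]
  exact (isRegularAt_vertexRatFn_div d k hx).functionFieldMap

/-- The generic point of `P̃` maps to the generic point of `ℙ^{d+1}`, hence lies over every
non-empty open. [folklore] -/
theorem genericPoint_mem_preimage {U : (Proj (grading (Fin (d + 1 + 1)) k)).Opens}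
    (hU : genericPoint (Proj (grading (Fin (d + 1 + 1)) k)) ∈ U) : genericPoint P ∈ b ⁻¹ᵁ U := by
  change b (genericPoint P) ∈ U
  rwa [genericPoint_eq_of_isDominant b]

/-- **Sections pull back to the pulled-back rational functions**: for an open `U ⊆ ℙ^{d+1}`,
`W ⊆ b⁻¹ U` containing the generic point and `s ∈ Γ(U)`, the rational function of `b^*s|_W` is
`b^*` of the rational function of `s`. [folklore] -/
theorem ofSection_appLE_eq {U : (Proj (grading (Fin (d + 1 + 1)) k)).Opens}
    (hU : genericPoint (Proj (grading (Fin (d + 1 + 1)) k)) ∈ U) (W : P.Opens) (hW : W ≤ b ⁻¹ᵁ U)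
    (hη : genericPoint P ∈ W) (s : Γ(Proj (grading (Fin (d + 1 + 1)) k), U)) :
    ofSection hη (b.appLE U W hW s) = functionFieldMap b (ofSection hU s) := by
  -- read both sides at the generic point of `P̃`
  have hbη : b (genericPoint P) ∈ U := hW hη
  have h1 : ofSection hU s =
      toFunctionField (b (genericPoint P)) ((Proj (grading (Fin (d + 1 + 1)) k)).presheaf.germ _ _ hbη s) :=
    ofSection_eq_toFunctionField hbη s
  rw [h1, functionFieldMap_toFunctionField, Scheme.Hom.germ_stalkMap_apply,
    ← ofSection_eq_toFunctionField (U := b ⁻¹ᵁ U) (show genericPoint P ∈ b ⁻¹ᵁ U from hW hη),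
    Scheme.Hom.appLE, CommRingCat.comp_apply, ofSection_map]

/-- The same for `b^*s ∈ Γ(P̃, b⁻¹ U)` itself. [folklore] -/
theorem ofSection_app_eq {U : (Proj (grading (Fin (d + 1 + 1)) k)).Opens}
    (hU : genericPoint (Proj (grading (Fin (d + 1 + 1)) k)) ∈ U) (s : Γ(Proj (grading (Fin (d + 1 + 1)) k), U)) :
    ofSection (genericPoint_mem_preimage b hU) (b.app U s) = functionFieldMap b (ofSection hU s) := by
  rw [← ofSection_appLE_eq b hU (b ⁻¹ᵁ U) le_rfl (genericPoint_mem_preimage b hU) s, Scheme.Hom.appLE,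
    CommRingCat.comp_apply, ofSection_map]

/-- The case of the last chart `U = D₊(x_{d+1})`. [folklore] -/
theorem ofSection_appLE (W : P.Opens) (hW : W ≤ b ⁻¹ᵁ (lastChart d k : (Proj (grading (Fin (d + 1 + 1)) k)).Opens))
    (hη : genericPoint P ∈ W)
    (s : Γ(Proj (grading (Fin (d + 1 + 1)) k), (lastChart d k : (Proj (grading (Fin (d + 1 + 1)) k)).Opens))) :
    ofSection hη (b.appLE _ W hW s) =
      functionFieldMap b (ofSection (genericPoint_mem_lastChart d k) s) :=
  ofSection_appLE_eq b (genericPoint_mem_lastChart d k) W hW hη s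

/-- The generic point of `P̃` lies over the last chart. [folklore] -/
theorem genericPoint_mem_preimage_lastChart :
    genericPoint P ∈ b ⁻¹ᵁ (lastChart d k : (Proj (grading (Fin (d + 1 + 1)) k)).Opens) :=
  genericPoint_mem_preimage b (genericPoint_mem_lastChart d k)

/-- The section `b^*(xⱼ/x_{d+1}) ∈ Γ(P̃, b⁻¹ D₊(x_{d+1}))`. [folklore] -/
abbrev blowupSection (j : Fin (d + 1)) :
    Γ(P, b ⁻¹ᵁ (lastChart d k : (Proj (grading (Fin (d + 1 + 1)) k)).Opens)) :=
  b.app _ (vertexSection d k j)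

/-- The rational function of `b^*(xⱼ/x_{d+1})` is `z_j`. [folklore] -/
theorem ofSection_blowupSection (j : Fin (d + 1)) :
    ofSection (genericPoint_mem_preimage_lastChart b) (blowupSection b j) = blowupRatFn b j := by
  have h := ofSection_appLE b (b ⁻¹ᵁ (lastChart d k : (Proj (grading (Fin (d + 1 + 1)) k)).Opens))
    le_rfl (genericPoint_mem_preimage_lastChart b) (vertexSection d k j)
  rw [ofSection_vertexSection] at h
  change _ = functionFieldMap b (vertexRatFn d k j)
  rw [← h, blowupSection, Scheme.Hom.appLE, CommRingCat.comp_apply, ofSection_map]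

/-! ## Regularity on the charts over `D₊(x_{d+1})` -/

/-- **On a principal affine piece `W` of the `i`-th chart, `z_l/zᵢ` is the rational function of
the quotient `c` with `b^*(xₗ/x_{d+1}) = c · b^*(xᵢ/x_{d+1})` on `W`** (the latter generates the
exceptional ideal there). [cite: StacksProject, Tag 0804] -/
theorem exists_ofSection_eq_blowupRatFn_div {W : P.affineOpens} {i : Fin (d + 1)}
    (hW : IsPrincipalChart b (vertexIdealSheaf d k) (lastChart d k) (vertexSection d k i) W)
    (hη : genericPoint P ∈ (W : P.Opens)) (l : Fin (d + 1)) :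
    ∃ c : Γ(P, W), ofSection hη c = blowupRatFn b l / blowupRatFn b i := by
  obtain ⟨c, hc⟩ := hW.exists_eq_mul (vertexSection_mem d k l)
  refine ⟨c, ?_⟩
  rw [eq_div_iff (blowupRatFn_ne_zero b i)]
  have hl := ofSection_appLE b W hW.le_preimage hη (vertexSection d k l)
  have hi := ofSection_appLE b W hW.le_preimage hη (vertexSection d k i)
  rw [ofSection_vertexSection] at hl hi
  change ofSection hη c * functionFieldMap b (vertexRatFn d k i) = functionFieldMap b (vertexRatFn d k l)
  rw [← hl, ← hi, ← ofSection_mul, ← hc]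

/-- **On the `i`-th chart `Spec k[X][I/Xᵢ] → P̃`, `z_l/zᵢ` is regular** (every point of the
principal chart lies in a principal affine piece). [cite: StacksProject, Tag 0804] -/
theorem isRegularAt_blowupRatFn_div_of_mem_opensRange (hb : IsBlowup b (vertexIdealSheaf d k))
    {i : Fin (d + 1)} {x : P} (hx : x ∈ (vertexChart hb i).opensRange) (l : Fin (d + 1)) :
    IsRegularAt x (blowupRatFn b l / blowupRatFn b i) := by
  rw [opensRange_vertexChart, mem_blowupChart_iff] at hx
  obtain ⟨W, hW, hxW⟩ := hx
  obtain ⟨c, hc⟩ := exists_ofSection_eq_blowupRatFn_div b hW (genericPoint_mem_of_mem hxW) l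
  rw [← hc, ofSection_eq_toFunctionField hxW]
  exact isRegularAt_germ hxW c

/-! ## The rational map `(z₀ : … : z_d)` is defined everywhere -/

/-- `b⁻¹ D₊(x_j)` lies in the `j`-th chart of the linear system of `z`. [folklore] -/
theorem preimage_basicOpen_le_lsChart (j : Fin (d + 1)) :
    b ⁻¹ᵁ Proj.basicOpen (grading (Fin (d + 1 + 1)) k) (MvPolynomial.X (Fin.castSucc j)) ≤
      lsChart (blowupRatFn b) j := fun _ hx =>
  (mem_lsChart_iff _).mpr ⟨blowupRatFn_ne_zero b j, fun _ =>
    isRegularAt_blowupRatFn_div_of_mem_basicOpen b hx⟩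

/-- The `i`-th chart `Spec k[X][I/Xᵢ] → P̃` lies in the `i`-th chart of the linear system of `z`.
[folklore] -/
theorem opensRange_vertexChart_le_lsChart (hb : IsBlowup b (vertexIdealSheaf d k)) (i : Fin (d + 1)) :
    (vertexChart hb i).opensRange ≤ lsChart (blowupRatFn b) i := fun _ hx =>
  (mem_lsChart_iff _).mpr ⟨blowupRatFn_ne_zero b i, fun l =>
    isRegularAt_blowupRatFn_div_of_mem_opensRange b hb hx l⟩

/-- **The rational map `(z₀ : … : z_d) : P̃ ⋯→ ℙ^d` is defined at every point of `P̃`**: over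
`D₊(x_j)`, `j ≤ d`, through the `j`-th chart, and over `D₊(x_{d+1})` through the chart of the
principal chart `P̃[D₊(x_{d+1}), xᵢ/x_{d+1}]` containing the point.
[cite: DeJong1996, Lemma 4.11 (proof), p. 68] -/
theorem isDefinedAt_blowupRatFn (hb : IsBlowup b (vertexIdealSheaf d k)) (x : P) :
    IsDefinedAt (blowupRatFn b) x := by
  rcases mem_preimage_basicOpen_or_mem_opensRange hb x with ⟨j, hj⟩ | ⟨i, hi⟩
  · exact ⟨j, preimage_basicOpen_le_lsChart b j hj⟩
  · exact ⟨i, opensRange_vertexChart_le_lsChart b hb i hi⟩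

end RatFn

end DeJong1996

end Literature.AlgebraicGeometry.Resolution

end
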